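import Literature.AlgebraicGeometry.Resolution.MuPQuotientLocalUniformization
import Summits.ResolutionOfSingularities.ResolutionOfSingularities.Theorems.SoloInformedMuPTorsor
import HarnessLib

/-!
# The `μ_p`-quotient (Frobenius-sandwich) face of the local core of resolution in characteristic `p`

Solo unit `solo-ResolutionOfSingularities-informed`. Companion to `SoloInformedMuPTorsor.lean`,
built on the Literature file `MuPQuotientLocalUniformization.lean`
(`muPTorsorLocalUniformization_iff_muPQuotient : MuPTorsorLocalUniformization p ↔
MuPQuotientLocalUniformization p`, unconditionally, valuation ring by valuation ring).

Over a perfect ground field of characteristic `p` the local half of the summit has two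
equivalent faces: ASCENT of local uniformization along `K₀ ⊆ K₀(a^{1/p})` (valuations on
`μ_p`-torsors `t^p = f` over regular varieties) and DESCENT along the same extensions (valuations
on quotients of regular varieties by `p`-closed rational vector fields, `K₀ = K₀(a^{1/p})^D`).
This file records the summit-side consequences of the second face:

* NECESSITY — `muPQuotientLocalUniformization_of_resolutionInChar`,
  `muPQuotientLocalUniformization_of_resolutionOfSingularities`; and the POINTWISE kill switches
  `not_resolutionOfSingularities_of_not_muPQuotientStepsAt`,
  `not_resolutionOfSingularities_of_not_muPTorsorStepsAt`: ONE valuation ring `O` of ONE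
  extension `K/k` of a perfect field of characteristic `p` at which a single quotient step
  (resp. torsor step) fails refutes resolution of singularities in positive characteristic.
* SUFFICIENCY OVER PERFECT FIELDS, GIVEN PATCHING — `hasResolution_of_muPQuotient_of_projPatching`:
  Temkin's inseparable local uniformization (`Temkin2013`, named fact), the quotient face
  `MuPQuotientLocalUniformization p`, and two-model patching of projective models over the perfect
  field `k` give weak resolution of every reduced separated `k`-scheme of finite type (the
  `k`-instance of `ResolutionInChar p`), via `hasResolution_of_muPTorsor_of_projPatching`.
-/

noncomputable section

open CategoryTheory AlgebraicGeometry IsLocalRing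
open Literature.AlgebraicGeometry Literature.AlgebraicGeometry.Resolution

namespace Summit.ResolutionOfSingularities.ResolutionOfSingularities.Theorems

universe u

/-- **Resolution in characteristic `p` implies local uniformization of valuations on
`μ_p`-quotients** (descent of local uniformization along `K₀ ⊆ K₀(a^{1/p})`, over perfect ground
fields of characteristic `p`). -/
theorem muPQuotientLocalUniformization_of_resolutionInChar {p : ℕ} [Fact p.Prime]
    (h : ResolutionInChar.{u} p) : MuPQuotientLocalUniformization.{u} p :=
  h.localUniformizationInChar.perfect.muPQuotient

/-- **The summit implies the `μ_p`-quotient case of local uniformization for every prime `p`.** -/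
theorem muPQuotientLocalUniformization_of_resolutionOfSingularities
    (h : Literature.AlgebraicGeometry.Resolution.ResolutionOfSingularities) (p : ℕ)
    (hp : p.Prime) : MuPQuotientLocalUniformization.{0} p :=
  haveI : Fact p.Prime := ⟨hp⟩
  muPQuotientLocalUniformization_of_resolutionInChar (h p hp)

/-- **Kill switch (quotient face, global)**: a prime `p` for which the quotient form of local
uniformization over perfect fields fails refutes resolution of singularities in positive
characteristic. -/
theorem not_resolutionOfSingularities_of_not_muPQuotient {p : ℕ} (hp : p.Prime)
    (h : ¬ MuPQuotientLocalUniformization.{0} p) :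
    ¬ Literature.AlgebraicGeometry.Resolution.ResolutionOfSingularities :=
  fun hR => h (muPQuotientLocalUniformization_of_resolutionOfSingularities hR p hp)

/-- **Kill switch (quotient face, pointwise)**: ONE valuation ring `O` of ONE extension `K` of a
perfect field `k` of characteristic `p`, ONE finitely generated `K₀ ⊆ K` and ONE `a` with
`a ^ p ∈ K₀` such that `O ∩ K₀(a)` is locally uniformizable over `k` but `O ∩ K₀` is not, refute
resolution of singularities in positive characteristic. -/
theorem not_resolutionOfSingularities_of_not_muPQuotientStepsAt {p : ℕ} (hp : p.Prime)
    {k K : Type} [Field k] [CharP k p] [PerfectField k] [Field K] [Algebra k K]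
    (O : ValuationSubring K) (h : ¬ MuPQuotientStepsAt p k O) :
    ¬ Literature.AlgebraicGeometry.Resolution.ResolutionOfSingularities :=
  fun hR => h (muPQuotientLocalUniformization_of_resolutionOfSingularities hR p hp k K O)

/-- **Kill switch (torsor face, pointwise)**: ONE valuation ring `O` of ONE extension `K` of a
perfect field `k` of characteristic `p`, ONE `K₀ ⊆ K` and ONE `a` with `a ^ p ∈ K₀` such that
`O ∩ K₀` is locally uniformizable over `k` but `O ∩ K₀(a)` is not, refute resolution of
singularities in positive characteristic. -/
theorem not_resolutionOfSingularities_of_not_muPTorsorStepsAt {p : ℕ} (hp : p.Prime)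
    {k K : Type} [Field k] [CharP k p] [PerfectField k] [Field K] [Algebra k K]
    (O : ValuationSubring K) (h : ¬ MuPTorsorStepsAt p k O) :
    ¬ Literature.AlgebraicGeometry.Resolution.ResolutionOfSingularities :=
  fun hR => h ((muPTorsorLocalUniformization_iff_forall_stepsAt p).mp
    (muPTorsorLocalUniformization_of_resolutionOfSingularities hR p hp) k K O)

/-- **Local uniformization over a perfect field from the `μ_p`-quotient case**: under `Temkin2013`
and `MuPQuotientLocalUniformization p`, every valuation ring `O ⊇ k` of a finitely generated
extension of a perfect field `k` of characteristic `p` is locally uniformizable. -/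
theorem isLocallyUniformizable_of_muPQuotient {p : ℕ} [Fact p.Prime] (hT : Temkin2013.{u})
    (H : MuPQuotientLocalUniformization.{u} p) {k K : Type u} [Field k] [CharP k p]
    [PerfectField k] [Field K] [Algebra k K] (hfg : (⊤ : IntermediateField k K).FG)
    (O : ValuationSubring K) (hk : ∀ c : k, algebraMap k K c ∈ O) :
    IsLocallyUniformizable k K O :=
  isLocallyUniformizable_of_muPTorsor hT (muPTorsorLocalUniformization_iff_muPQuotient.mpr H)
    hfg O hk

/-- **Resolution over a perfect field of characteristic `p` from: Temkin's inseparable local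
uniformization, the `μ_p`-QUOTIENT case of local uniformization (local uniformization of
valuations on quotients of regular varieties by `p`-closed rational vector fields), and two-model
patching of projective models over `k`** (Piltant 2013, Prop. 5.1 with `P = P_reg`; known for
`trdeg ≤ 3`, open beyond). The `k`-instance of `ResolutionInChar p`. -/
theorem hasResolution_of_muPQuotient_of_projPatching {p : ℕ} [Fact p.Prime]
    (hT : Temkin2013.{u}) (H : MuPQuotientLocalUniformization.{u} p) {k : Type u} [Field k]
    [CharP k p] [PerfectField k]
    (hZ : ∀ (K : Type u) [Field K] [Algebra k K] [Algebra.EssFiniteType k K],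
      ∀ M₁ M₂ : ProjModel k K,
        ∃ (N : ProjModel k K) (φ₁ : N.Hom M₁) (φ₂ : N.Hom M₂), φ₁.RegLe ∧ φ₂.RegLe)
    (X : Scheme.{u}) (f : X ⟶ Spec (.of k)) (hs : IsSeparated f) (hl : LocallyOfFiniteType f)
    (hq : QuasiCompact f) (hr : IsReduced X) : Scheme.HasResolution X :=
  hasResolution_of_muPTorsor_of_projPatching hT (muPTorsorLocalUniformization_iff_muPQuotient.mpr H)
    hZ X f hs hl hq hr

/-- The same, packaged as the `k`-instance of `ResolutionOverUpToDim k d` for every `d`. -/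
theorem resolutionOverUpToDim_of_muPQuotient_of_projPatching {p : ℕ} [Fact p.Prime]
    (hT : Temkin2013.{u}) (H : MuPQuotientLocalUniformization.{u} p) {k : Type u} [Field k]
    [CharP k p] [PerfectField k]
    (hZ : ∀ (K : Type u) [Field K] [Algebra k K] [Algebra.EssFiniteType k K],
      ∀ M₁ M₂ : ProjModel k K,
        ∃ (N : ProjModel k K) (φ₁ : N.Hom M₁) (φ₂ : N.Hom M₂), φ₁.RegLe ∧ φ₂.RegLe)
    (d : ℕ) : ResolutionOverUpToDim k d :=
  fun X f hs hl hq hr _ => hasResolution_of_muPQuotient_of_projPatching hT H hZ X f hs hl hq hr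

end Summit.ResolutionOfSingularities.ResolutionOfSingularities.Theorems

end
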